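import Literature.Analysis.SpecialFunctions.ContinuousMultiplicativeCharacterSmooth   -- ★ LH3-p04 (g2): `exists_forall_eq_mul_cexp_of_map_mul_complex` (the global two-exponent form)
import HarnessLib

/-!
# The SHAPE of a continuous multiplicative character of `ℂˣ`: `χ z = (z∕‖z‖)^m · ‖z‖^s` with `m ∈ ℤ`, `s ∈ ℂ`; trivial on `ℝ_{>0}` ⇒ `s = 0`; `χ(−1) = −1` ⇒ `m` odd
# (Tate's thesis §2.3 «`c(α) = c̃(α)‖α‖^s`»; Rogawski 1990 §8.2 p. 119 «for some integer `t`, `μ⁻¹(z) = z|z|⁻¹(z∕z̄)^t`»)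

Topic `Analysis/SpecialFunctions`; namespace `Literature.Analysis.SpecialFunctions`.  THEOREMS ONLY (no `def`, no instance, no notation, no axiom, no `sorry`); Mathlib + the sibling ★
`ContinuousMultiplicativeCharacterSmooth`.  Cell `pub/hodgecm-mathlib`, line LH3 (closer stub `stub_N9`, crux H413 = `stmt-HodgeConjecture-24833`), brick **(μ∞-shape)** of the (D-i-def) chain
(LH3-plan (g2) DEALER WORDS #3; LH3-p04 (g2) census 2026-09-02): the integrality∕parity structure of the place factors `F_w = μ_∞ ∘ ι_w` of a Hecke character that decides whether
`F_w(A)⁻¹·|A|` extends smoothly across `A = 0` — Rogawski's «`μ⁻¹(z) = z|z|⁻¹(z∕z̄)^t`», i.e. `F_w z = (z∕|z|)^{−(2t+1)}`: NO modulus part and an ODD circle exponent, which is what the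
μ-guard `μ|_{𝔸_{L⁺}^×} = ω_{L∕L⁺}` forces at infinity (`F_w|_{ℝ^×} = sgn`; brick (μ-guard-∞)).

THE MATHEMATICS [TateThesis1967 §2.3].  From ★ `exists_forall_eq_mul_cexp_of_map_mul_complex` at `z₀ = 1`: `χ z = exp(c₁ log‖z‖) · exp(c₂ arg z)` (`χ 1 = 1`, `log z = log‖z‖ + i arg z`).
Squaring `χ(−1) = exp(c₂ π)` against `χ(−1)² = χ 1 = 1` gives `exp(2π c₂) = 1`, so `c₂ = i m` with `m ∈ ℤ` (Mathlib `Complex.exp_eq_one_iff`), and `exp(i m arg z) = (exp(i arg z))^m =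
(z∕‖z‖)^m`.  If `χ r = 1` for all real `r > 0` then `exp(s log r) = 1` for all `r > 0`, whence `s = 0` (take `r = e^{t}`, `t` small: `exp(s t) = 1` near `0` forces `s = 0`).  If moreover
`χ(−1) = −1` then `(−1)^m = −1`, so `m` is odd.

WHAT IS PROVED.
* **`exists_int_eq_zpow_mul_cexp_of_map_mul_complex`** — `∃ (m : ℤ) (s : ℂ), ∀ z ≠ 0, χ z = (z ∕ ‖z‖)^m · exp(s · log ‖z‖)`.
* **`exists_int_eq_zpow_of_map_mul_complex_of_forall_pos`** — if also `χ r = 1` for every real `r > 0`: `∃ m : ℤ, ∀ z ≠ 0, χ z = (z ∕ ‖z‖)^m`.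
* **`exists_odd_eq_zpow_of_map_mul_complex_of_forall_pos_of_neg_one`** — if moreover `χ (−1) = −1`: the same with `Odd m` — Rogawski's shape.
HONEST LABEL: HC_CM is proved only modulo the 7 printed citations (2 remaining: hLiu418 = stmt-HodgeConjecture-24832, h413 = stmt-HodgeConjecture-24833) until rung 0 closes; this file
is real analysis and pays nothing by itself.

## References
* [TateThesis1967] J. Tate, *Fourier analysis in number fields and Hecke's zeta-functions* (1950), in Cassels–Fröhlich, *Algebraic Number Theory* (1967), §2.3.
* [Rogawski1990] J. D. Rogawski, *Automorphic Representations of Unitary Groups in Three Variables*, Ann. of Math. Stud. 123 (1990), §8.2 p. 119 (`μ⁻¹(z) = z|z|⁻¹(z∕z̄)^t`), §4.9 p. 55.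
-/

set_option autoImplicit false

noncomputable section

open Complex Filter Topology Set

namespace Literature.Analysis.SpecialFunctions

/-- **SHAPE `χ z = (z∕‖z‖)^m · exp(s·log‖z‖)`, `m ∈ ℤ`, `s ∈ ℂ`**, for a multiplicative `χ` on `ℂ ∖ {0}` continuous and non-vanishing there (the circle exponent is an INTEGER because
`χ(−1)² = χ(1) = 1` pins `exp(2π c₂) = 1`). [cite: TateThesis1967, §2.3] [cite: Rogawski1990, §8.2 p. 119] -/
theorem exists_int_eq_zpow_mul_cexp_of_map_mul_complex {χ : ℂ → ℂ} (hmul : ∀ a b : ℂ, a ≠ 0 → b ≠ 0 → χ (a * b) = χ a * χ b)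
    (hcont : ∀ a : ℂ, a ≠ 0 → ContinuousAt χ a) (hne : ∀ a : ℂ, a ≠ 0 → χ a ≠ 0) :
    ∃ (m : ℤ) (s : ℂ), ∀ z : ℂ, z ≠ 0 → χ z = (z / (‖z‖ : ℂ)) ^ m * cexp (s * (Real.log ‖z‖ : ℂ)) := by
  have h1 : χ 1 = 1 := map_one_of_map_mul_of_ne_zero hmul hne
  obtain ⟨c₁, c₂, hform⟩ := exists_forall_eq_mul_cexp_of_map_mul_complex hmul hcont hne
  -- the form at base point `1`
  have hform1 : ∀ z : ℂ, z ≠ 0 → χ z = cexp (c₁ * (Real.log ‖z‖ : ℂ)) * cexp (c₂ * (arg z : ℂ)) := by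
    intro z hz
    have h := hform 1 z one_ne_zero hz
    rw [h1, one_mul, div_one, Complex.log_re, Complex.log_im] at h
    exact h
  -- `exp (2π c₂) = 1` from `χ(−1)² = 1`
  have hneg1 : χ (-1) = cexp (c₂ * (Real.pi : ℂ)) := by
    have h := hform1 (-1) (neg_ne_zero.mpr one_ne_zero)
    rw [norm_neg, norm_one, Real.log_one, Complex.ofReal_zero, mul_zero, Complex.exp_zero, one_mul, Complex.arg_neg_one] at h
    exact h
  have hsq : cexp (c₂ * (Real.pi : ℂ)) * cexp (c₂ * (Real.pi : ℂ)) = 1 := by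
    rw [← hneg1, ← hmul _ _ (neg_ne_zero.mpr one_ne_zero) (neg_ne_zero.mpr one_ne_zero), neg_mul_neg, one_mul, h1]
  have h2pi : cexp (c₂ * (2 * Real.pi)) = 1 := by
    rw [show c₂ * (2 * (Real.pi : ℂ)) = c₂ * Real.pi + c₂ * Real.pi by ring, Complex.exp_add, hsq]
  obtain ⟨m, hm⟩ := Complex.exp_eq_one_iff.mp h2pi
  have hc₂ : c₂ = m * I := by
    have hπ : (2 * (Real.pi : ℂ)) ≠ 0 := mul_ne_zero two_ne_zero (Complex.ofReal_ne_zero.mpr Real.pi_ne_zero)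
    have : c₂ * (2 * Real.pi) = (m * I) * (2 * Real.pi) := by rw [hm]; ring
    exact mul_right_cancel₀ hπ this
  refine ⟨m, c₁, fun z hz => ?_⟩
  have hnorm : (‖z‖ : ℂ) ≠ 0 := Complex.ofReal_ne_zero.mpr (norm_ne_zero_iff.mpr hz)
  have harg : cexp (c₂ * (arg z : ℂ)) = (z / (‖z‖ : ℂ)) ^ m := by
    rw [hc₂, show (m : ℂ) * I * (arg z : ℂ) = m * ((arg z : ℂ) * I) by ring, Complex.exp_int_mul]
    congr 1
    rw [eq_div_iff hnorm, mul_comm]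
    exact norm_mul_exp_arg_mul_I z
  rw [hform1 z hz, harg, mul_comm]

/-- **TRIVIAL ON `ℝ_{>0}` ⇒ NO MODULUS PART: `χ z = (z∕‖z‖)^m`** (if `χ r = 1` for every real `r > 0` then `exp(s t) = 1` for all real `t`, so `s = 0`).
[cite: TateThesis1967, §2.3] [cite: Rogawski1990, §8.2 p. 119] -/
theorem exists_int_eq_zpow_of_map_mul_complex_of_forall_pos {χ : ℂ → ℂ} (hmul : ∀ a b : ℂ, a ≠ 0 → b ≠ 0 → χ (a * b) = χ a * χ b)
    (hcont : ∀ a : ℂ, a ≠ 0 → ContinuousAt χ a) (hne : ∀ a : ℂ, a ≠ 0 → χ a ≠ 0) (hpos : ∀ r : ℝ, 0 < r → χ (r : ℂ) = 1) :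
    ∃ m : ℤ, ∀ z : ℂ, z ≠ 0 → χ z = (z / (‖z‖ : ℂ)) ^ m := by
  obtain ⟨m, s, hform⟩ := exists_int_eq_zpow_mul_cexp_of_map_mul_complex hmul hcont hne
  -- `exp (s t) = 1` for every real `t`
  have hexp : ∀ t : ℝ, cexp (s * (t : ℂ)) = 1 := by
    intro t
    have hr : (0 : ℝ) < Real.exp t := Real.exp_pos t
    have h := hform (Real.exp t : ℂ) (Complex.ofReal_ne_zero.mpr hr.ne')
    rw [hpos _ hr, Complex.norm_real, Real.norm_eq_abs, abs_of_pos hr, Real.log_exp, div_self (Complex.ofReal_ne_zero.mpr hr.ne'), one_zpow, one_mul] at h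
    exact h.symm
  -- hence `s = 0`: differentiate `t ↦ exp (s t) = 1` at `0`
  have hs : s = 0 := by
    have hd : HasDerivAt (fun t : ℝ => cexp (s * (t : ℂ))) (s * 1) 0 := by
      have h0 : HasDerivAt (fun t : ℝ => s * (t : ℂ)) (s * 1) 0 := (Complex.ofRealCLM.hasDerivAt (x := (0 : ℝ))).const_mul s
      have := h0.cexp
      simp only [Complex.ofReal_zero, mul_zero, Complex.exp_zero, one_mul] at this
      exact this
    have hconst : HasDerivAt (fun _ : ℝ => (1 : ℂ)) 0 0 := hasDerivAt_const 0 1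
    have heq : (fun t : ℝ => cexp (s * (t : ℂ))) = fun _ => (1 : ℂ) := funext hexp
    rw [heq] at hd
    have := hd.unique hconst
    rwa [mul_one] at this
  refine ⟨m, fun z hz => ?_⟩
  rw [hform z hz, hs, zero_mul, Complex.exp_zero, mul_one]

/-- **ROGAWSKI'S SHAPE: trivial on `ℝ_{>0}` and `χ(−1) = −1` ⇒ `χ z = (z∕‖z‖)^m` with `m` ODD** («for some integer `t`, `μ⁻¹(z) = z|z|⁻¹(z∕z̄)^t`», i.e. `μ(z) = (z∕|z|)^{−(2t+1)}`) —
the archimedean consequence of the μ-guard `μ|_{𝔸_{L⁺}^×} = ω_{L∕L⁺}` (`F_w|_{ℝ^×} = sgn`). [cite: Rogawski1990, §8.2 p. 119] [cite: TateThesis1967, §2.3] -/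
theorem exists_odd_eq_zpow_of_map_mul_complex_of_forall_pos_of_neg_one {χ : ℂ → ℂ} (hmul : ∀ a b : ℂ, a ≠ 0 → b ≠ 0 → χ (a * b) = χ a * χ b)
    (hcont : ∀ a : ℂ, a ≠ 0 → ContinuousAt χ a) (hne : ∀ a : ℂ, a ≠ 0 → χ a ≠ 0) (hpos : ∀ r : ℝ, 0 < r → χ (r : ℂ) = 1) (hneg : χ (-1) = -1) :
    ∃ m : ℤ, Odd m ∧ ∀ z : ℂ, z ≠ 0 → χ z = (z / (‖z‖ : ℂ)) ^ m := by
  obtain ⟨m, hform⟩ := exists_int_eq_zpow_of_map_mul_complex_of_forall_pos hmul hcont hne hpos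
  refine ⟨m, ?_, hform⟩
  have h := hform (-1) (neg_ne_zero.mpr one_ne_zero)
  rw [hneg, norm_neg, norm_one, Complex.ofReal_one, div_one] at h
  rcases Int.even_or_odd m with hev | hodd
  · rw [hev.neg_one_zpow] at h
    exact absurd h (by norm_num)
  · exact hodd

end Literature.Analysis.SpecialFunctions

end
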